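/-
Copyright (c) 2026. All rights reserved.
Released under Apache 2.0 license as described in the file LICENSE.
-/
import Literature.MathematicalPhysics.QuantumLattice.HartreeFockBlochTorus
import HarnessLib

/-!
# Fermi projections of mean-field Hamiltonians and the UHF form of the Bloch bound

Topic `MathematicalPhysics/QuantumLattice`, family `hubbard`; companion of
`HartreeFockBlochTorus.lean`. The Bloch bound `HartreeFock.energyDensity2D_le_bloch` takes a family
of Hermitian idempotent cell-momentum blocks `Q σ κ`; in an unrestricted Hartree–Fock (UHF)
certificate these are the **Fermi projections** — the spectral projections onto the eigenvalues
below a Fermi level `μ_σ` — of the Bloch blocks `h σ κ` of a mean-field one-body Hamiltonian. This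
file supplies that construction and its three properties, so that such a certificate names only
`L`, the cell, the Hermitian matrices `h σ κ`, the Fermi levels and the eigenvalue COUNTS:

* `HartreeFock.fermiProj hA μ := U · diag[λ_i < μ] · Uᴴ` for a Hermitian matrix `A = U diag(λ) Uᴴ`
  (Mathlib's `Matrix.IsHermitian.eigenvectorUnitary` / `eigenvalues`);
* `isHermitian_fermiProj`, `fermiProj_mul_self`, `trace_fermiProj` (`tr = #{i | λ_i < μ}`);
* **`HartreeFock.energyDensity2D_le_uhf`** — `e(t,U; 2m/L²) ≤ re blochEnergy t U (σ κ ↦ fermiProj …)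
  / L² + 16|t|/L` whenever `Σ_{σ,κ} #{λ_i(h σ κ) < μ_σ} = 2m` (`m < L²`, `U ≥ 0`, `L ≥ 3`), and the
  finite-volume form `hubbardTorus_groundEnergyAt_le_uhf` (all `d`).

Everything is proved; the one definition has a body; no named facts.

## Mathlib / tree search

Mathlib (REUSED): `Matrix.IsHermitian.eigenvectorUnitary`, `Matrix.IsHermitian.eigenvalues`,
`Unitary.coe_star_mul_self`, `Matrix.isHermitian_mul_mul_conjTranspose`, `Matrix.trace_mul_comm`,
`Finset.sum_boole`. Tree: `HartreeFock.energyDensity2D_le_bloch`,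
`HartreeFock.hubbardTorus_groundEnergyAt_le_bloch` (`HartreeFockBlochTorus`); an eigenprojection AT
one energy exists (`ClusterPairBosonCouplings.eigenProj`), a projection BELOW a level did not
(`lean search 'fermiProj|spectralProj|projBelow'`).

## References

* V. Bach, E. H. Lieb, J. P. Solovej, J. Stat. Phys. 76 (1994) 3, Thm 3.10 / eq. (2c.36) (the
  Hartree–Fock ground state of a one-body operator is its Fermi projection). [BachLiebSolovej1994]
-/

noncomputable section

namespace Literature.MathematicalPhysics.QuantumLattice

namespace HartreeFock

open Matrix Finset Literature.Probability.LatticeModels HeisenbergTL ThermodynamicLimit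

/-! ### The Fermi projection of a Hermitian matrix -/

section FermiProj

variable {n : Type*} [Fintype n] [DecidableEq n] {A : Matrix n n ℂ}

/-- **The Fermi projection** of a Hermitian matrix `A` at level `μ`: the spectral projection onto
the span of the eigenvectors with eigenvalue `< μ`, `U · diag[λ_i < μ] · Uᴴ` in Mathlib's
eigenvector unitary `U`. BLS94 Thm 3.10 (the HF minimiser of a one-body operator).
[cite: BachLiebSolovej1994, eq. (2c.36)] -/
def fermiProj (hA : A.IsHermitian) (μ : ℝ) : Matrix n n ℂ :=
  (hA.eigenvectorUnitary : Matrix n n ℂ) *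
    diagonal (fun i => if hA.eigenvalues i < μ then (1 : ℂ) else 0) *
      (hA.eigenvectorUnitary : Matrix n n ℂ)ᴴ

/-- The Fermi projection is Hermitian. [folklore] -/
theorem isHermitian_fermiProj (hA : A.IsHermitian) (μ : ℝ) : (fermiProj hA μ).IsHermitian := by
  unfold fermiProj
  refine Matrix.isHermitian_mul_mul_conjTranspose _ (isHermitian_diagonal_iff.2 fun i => ?_)
  rw [isSelfAdjoint_iff]
  split_ifs <;> simp

/-- The Fermi projection is idempotent. [folklore] -/
theorem fermiProj_mul_self (hA : A.IsHermitian) (μ : ℝ) :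
    fermiProj hA μ * fermiProj hA μ = fermiProj hA μ := by
  unfold fermiProj
  set U : Matrix n n ℂ := (hA.eigenvectorUnitary : Matrix n n ℂ) with hU
  set D : Matrix n n ℂ := diagonal (fun i => if hA.eigenvalues i < μ then (1 : ℂ) else 0) with hD
  have hUU : Uᴴ * U = 1 := by
    rw [hU, ← Matrix.star_eq_conjTranspose]
    exact Unitary.coe_star_mul_self hA.eigenvectorUnitary
  have hDD : D * D = D := by
    rw [hD, diagonal_mul_diagonal]
    congr 1
    funext i
    split_ifs <;> simp
  calc U * D * Uᴴ * (U * D * Uᴴ) = U * (D * ((Uᴴ * U) * (D * Uᴴ))) := by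
        simp only [Matrix.mul_assoc]
    _ = U * D * Uᴴ := by rw [hUU, Matrix.one_mul, ← Matrix.mul_assoc D, hDD, Matrix.mul_assoc]

/-- **The trace of the Fermi projection is the number of eigenvalues below the level.**
[folklore] -/
theorem trace_fermiProj (hA : A.IsHermitian) (μ : ℝ) :
    (fermiProj hA μ).trace = ((Finset.univ.filter fun i => hA.eigenvalues i < μ).card : ℂ) := by
  unfold fermiProj
  have hUU : (hA.eigenvectorUnitary : Matrix n n ℂ)ᴴ * (hA.eigenvectorUnitary : Matrix n n ℂ) =
      1 := by
    rw [← Matrix.star_eq_conjTranspose]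
    exact Unitary.coe_star_mul_self hA.eigenvectorUnitary
  rw [Matrix.trace_mul_comm, ← Matrix.mul_assoc, hUU, Matrix.one_mul, trace_diagonal,
    Finset.sum_boole]

end FermiProj

/-! ### The UHF form of the Bloch bound -/

section UHF

variable {d L : ℕ} [NeZero L] {k M : Fin d → ℕ} [∀ i, NeZero (k i)] [∀ i, NeZero (M i)]

/-- **Unrestricted Hartree–Fock upper bound, finite torus.** On `(ℤ/Lℤ)^d`, `L ≥ 3`, with a
rectangular magnetic cell (`k i · M i = L`): for Hermitian cell-momentum blocks `h σ κ` of any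
mean-field one-body Hamiltonian and Fermi levels `μ σ`, if the total number of eigenvalues below the
levels is `N`, then `E_L(t,U;N) ≤ re blochEnergy t U (σ κ ↦ fermiProj (h σ κ) (μ σ))`.
[cite: BachLiebSolovej1994, eq. (2c.36)] -/
theorem hubbardTorus_groundEnergyAt_le_uhf (hkM : ∀ i, k i * M i = L) (hL : 3 ≤ L) (t U : ℝ)
    {h : Fin 2 → RectTorusSite k → Matrix (RectTorusSite M) (RectTorusSite M) ℂ}
    (hh : ∀ σ κ, (h σ κ).IsHermitian) (μ : Fin 2 → ℝ) {N : ℕ}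
    (hN : ∑ σ, ∑ κ, (Finset.univ.filter fun i => (hh σ κ).eigenvalues i < μ σ).card = N) :
    groundEnergyAt (fermionTorusGraph d L) t U N ≤
      (blochEnergy t U fun σ κ => fermiProj (hh σ κ) (μ σ)).re := by
  refine hubbardTorus_groundEnergyAt_le_bloch hkM hL t U _ (fun σ κ => isHermitian_fermiProj _ _)
    (fun σ κ => fermiProj_mul_self _ _) ?_
  simp_rw [trace_fermiProj]
  exact_mod_cast congrArg (Nat.cast (R := ℂ)) hN

end UHF

section Thermodynamic

variable {L : ℕ} [NeZero L] {k M : Fin 2 → ℕ} [∀ i, NeZero (k i)] [∀ i, NeZero (M i)]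

/-- **Unrestricted Hartree–Fock upper bound on the square-lattice Hubbard energy density.** For
`U ≥ 0`, `L ≥ 3`, a rectangular magnetic cell `M 0 × M 1` (`k i · M i = L`), Hermitian blocks
`h σ κ`, Fermi levels `μ σ` with `Σ_{σ,κ} #{λ_i(h σ κ) < μ σ} = 2m`, `m < L²`:
`e(t,U; 2m/L²) ≤ re blochEnergy t U (σ κ ↦ fermiProj (h σ κ) (μ σ)) / L² + 16|t|/L`.
[cite: BachLiebSolovej1994, eq. (2c.36)] -/
theorem energyDensity2D_le_uhf (hkM : ∀ i, k i * M i = L) (hL : 3 ≤ L) (t : ℝ) {U : ℝ}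
    (hU : 0 ≤ U) {h : Fin 2 → RectTorusSite k → Matrix (RectTorusSite M) (RectTorusSite M) ℂ}
    (hh : ∀ σ κ, (h σ κ).IsHermitian) (μ : Fin 2 → ℝ) {m : ℕ} (hm : m < L * L)
    (hN : ∑ σ, ∑ κ, (Finset.univ.filter fun i => (hh σ κ).eigenvalues i < μ σ).card = 2 * m) :
    ThermodynamicLimit.energyDensity2D t U ((2 * m : ℕ) / (L : ℝ) ^ 2) ≤
      (blochEnergy t U fun σ κ => fermiProj (hh σ κ) (μ σ)).re / (L : ℝ) ^ 2 + 16 * |t| / L := by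
  refine energyDensity2D_le_bloch hkM hL t hU _ (fun σ κ => isHermitian_fermiProj _ _)
    (fun σ κ => fermiProj_mul_self _ _) hm ?_
  simp_rw [trace_fermiProj]
  exact_mod_cast congrArg (Nat.cast (R := ℂ)) hN

end Thermodynamic

end HartreeFock

end Literature.MathematicalPhysics.QuantumLattice
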